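import Summits.Parity.BatemanHorn.Theorems.AlmostPrimeZerosLinearCappedRepulsionRieszDiffNegligible
import HarnessLib

/-!
# Crux `DiscMajorantLog` (stmt-Parity-17114), line `Sketch`: the four negligible contour terms
for `R ≤ 4 log log x` (stub `stub_rieszDiffNegligibleWide`, wave 3, "E2a")

Support lemma `stub_rieszDiffNegligibleWide` (a registered stub of the line skeleton
`Cruxes/DiscMajorantLog/Lines/Sketch.lean`).  The tree's one-sided Selberg–Delange engine for a
DIFFERENCE of two Riesz means (`Summits/Parity/BatemanHorn/Theorems/
AlmostPrimeZerosLinearCappedRepulsionRieszDiff{Scales,Negligible}.lean`, Montgomery–Vaughan §7.4,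
proof of Theorem 7.17) bounds four "negligible" contour terms — the tails `|t| ≥ T`, the horizontal
sides, the left sides far from `1`, the left sides near `1` — each by `x² B e^{−ℓ³ − (R+1)ℓ}`, for
`T = e^{3ℓ³}`, `ℓ = log log x ≥ 2` and `0 ≤ R ≤ ℓ` (`RieszDiff.tails_le`, `hor_le`, `far_le`,
`near_le`).  Here the SAME four real inequalities are re-run on the wide range `0 ≤ R ≤ 4ℓ` with the
floor raised to `ℓ ≥ 6` (right-hand sides unchanged): `RieszDiffWide.tails_le_wide`,
`RieszDiffWide.hor_le_wide` (with `RieszDiffWide.far_factor_le_wide`), `RieszDiffWide.far_le_wide`,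
`RieszDiffWide.near_le_wide`, assembled into the registered ∀-closed conjunction.

Mathematics (all folklore, pure `exp`/`log`/`rpow` bookkeeping; the `R`-independent facts
`RieszDiff.scales`, `numerics`, `two_mul_rpow_line_le`, `two_mul_rpow_left_le`, `height_bounds`
are reused by import):
* tails: `L^R = e^{ℓR} ≤ e^{4ℓ²}`, `16e² ≤ e⁵`, and `5 + 4ℓ² − 3ℓ³ ≤ −ℓ³ − (4ℓ+1)ℓ` for `ℓ ≥ 6`;
* horizontal sides: `e^{RC₀} log(T+3)^R ≤ e^{4ℓC₀} e^{4ℓ(2+3ℓ)}`, `32e² ≤ e⁶`, `C₀ ≤ ℓ − 3`, and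
  `5ℓ³ ≥ 20ℓ² − 3ℓ + 6`;
* far left sides: `(2x)^{1+b} ≤ 4x² e^{−β}`, `β = L(1−b) ≥ (C₀+20)ℓ³`, `256 ≤ e⁶`, `4ℓC₀ ≤ C₀ℓ³`,
  `19ℓ³ ≥ 16ℓ² + 9ℓ + 6`;
* near left sides: `(1−b)^{−R} ≤ e^{4ℓ(1+3ℓ+Λ)}`, `2^R ≤ e^{4ℓ(1+3ℓ+Λ)}`,
  `e^{RM₀+πR} ≤ e^{4ℓ(M₀+4)}`, `β ≥ (M₀+Λ+20)ℓ³`, `128 ≤ e⁶`, `19ℓ³ ≥ 16ℓ² + 21ℓ + 6`.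

No definitions are introduced; nothing here depends on the route's Theses file.

## References

* [MontgomeryVaughan2007] H. L. Montgomery, R. C. Vaughan, *Multiplicative Number Theory I*,
  CUP 2007, §7.4, proof of Theorem 7.17 (pp. 177–178).
-/

noncomputable section

open scoped Real
open Summit.Parity.BatemanHorn.Cruxes.LinearCappedRepulsion.JensenStieltjesMajorant.RieszDiff

namespace Summit.Parity.BatemanHorn.Cruxes.DiscMajorantLog.Sketch

namespace RieszDiffWide

/-- Powers of `ℓ ≥ 6`: `0 < ℓ`, `36 ≤ ℓ²`, `6ℓ ≤ ℓ²`, `6ℓ² ≤ ℓ³`, `4ℓ ≤ ℓ³`. [folklore] -/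
theorem cubes {ℓ : ℝ} (hℓ6 : 6 ≤ ℓ) :
    0 < ℓ ∧ 36 ≤ ℓ ^ 2 ∧ 6 * ℓ ≤ ℓ ^ 2 ∧ 6 * ℓ ^ 2 ≤ ℓ ^ 3 ∧ 4 * ℓ ≤ ℓ ^ 3 := by
  have hℓ0 : 0 < ℓ := by linarith
  have h1 : 6 * ℓ ≤ ℓ ^ 2 := by rw [sq]; exact mul_le_mul_of_nonneg_right hℓ6 hℓ0.le
  have h3 : 6 * ℓ ^ 2 ≤ ℓ ^ 3 := by
    rw [pow_succ' ℓ 2]; exact mul_le_mul_of_nonneg_right hℓ6 (sq_nonneg ℓ)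
  exact ⟨hℓ0, by linarith, h1, h3, by linarith⟩

/-! ### The tails -/

/-- **The tails are negligible (wide range)**: `4·(2x)^{1+a} B L^R / T ≤ x² B e^{−ℓ³ − (R+1)ℓ}`
for `T = exp(3ℓ³)`, `R ≤ 4ℓ`, `ℓ = log log x ≥ 6`. [folklore] -/
theorem tails_le_wide {x L ℓ R B T : ℝ} (hx : 1 < x) (hL : L = Real.log x) (hℓ : ℓ = Real.log L)
    (hℓ6 : 6 ≤ ℓ) (hR4 : R ≤ 4 * ℓ) (hB : 0 ≤ B) (hT : T = Real.exp (3 * ℓ ^ 3)) :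
    4 * ((2 * x) ^ (1 + (1 + 1 / L)) * (B / (1 / L) ^ R) / T) ≤
      x ^ 2 * B * Real.exp (-ℓ ^ 3 - (R + 1) * ℓ) := by
  have hℓ2 : 2 ≤ ℓ := by linarith
  obtain ⟨hx0, hxL, hL0, hLℓ, hL7, hx2, -⟩ := scales hx hL hℓ hℓ2
  obtain ⟨hℓ0, hsq, h6ℓ, h6ℓ2, -⟩ := cubes hℓ6
  have hT0 : 0 < T := by rw [hT]; exact Real.exp_pos _
  have h2x := two_mul_rpow_line_le hx hL (by linarith)
  have hBL : B / (1 / L) ^ R = B * L ^ R := by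
    rw [Real.div_rpow zero_le_one hL0.le, Real.one_rpow]; field_simp
  have hLR : L ^ R ≤ Real.exp (4 * ℓ ^ 2) := by
    rw [Real.rpow_def_of_pos hL0, ← hℓ, Real.exp_le_exp]
    nlinarith [mul_le_mul_of_nonneg_left hR4 hℓ0.le]
  have hTinv : 1 / T = Real.exp (-(3 * ℓ ^ 3)) := by rw [hT, Real.exp_neg]; field_simp
  -- LHS ≤ 16 e² x² B e^{4ℓ²} e^{−3ℓ³}
  have h1 : 4 * ((2 * x) ^ (1 + (1 + 1 / L)) * (B / (1 / L) ^ R) / T) ≤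
      16 * Real.exp 2 * x ^ 2 * B * Real.exp (4 * ℓ ^ 2) * Real.exp (-(3 * ℓ ^ 3)) := by
    rw [hBL, div_eq_mul_one_div _ T, hTinv]
    have : (2 * x) ^ (1 + (1 + 1 / L)) * (B * L ^ R) ≤
        (4 * Real.exp 2 * x ^ 2) * (B * Real.exp (4 * ℓ ^ 2)) :=
      mul_le_mul h2x (mul_le_mul_of_nonneg_left hLR hB) (by positivity) (by positivity)
    calc 4 * ((2 * x) ^ (1 + (1 + 1 / L)) * (B * L ^ R) * Real.exp (-(3 * ℓ ^ 3)))
        ≤ 4 * ((4 * Real.exp 2 * x ^ 2) * (B * Real.exp (4 * ℓ ^ 2)) *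
            Real.exp (-(3 * ℓ ^ 3))) := by
          gcongr
      _ = _ := by ring
  refine h1.trans ?_
  -- 16 e² e^{4ℓ²} e^{−3ℓ³} ≤ e^{−ℓ³ − (R+1)ℓ}
  have h16 : (16 : ℝ) * Real.exp 2 ≤ Real.exp 5 := by
    have : Real.exp 5 = Real.exp 3 * Real.exp 2 := by rw [← Real.exp_add]; norm_num
    rw [this]; exact mul_le_mul_of_nonneg_right numerics.1 (Real.exp_pos _).le
  have hexp : Real.exp 5 * Real.exp (4 * ℓ ^ 2) * Real.exp (-(3 * ℓ ^ 3)) ≤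
      Real.exp (-ℓ ^ 3 - (R + 1) * ℓ) := by
    rw [← Real.exp_add, ← Real.exp_add, Real.exp_le_exp]
    -- need: 5 + 4ℓ² − 3ℓ³ ≤ −ℓ³ − (R+1)ℓ, using R ≤ 4ℓ, ℓ³ ≥ 6ℓ², ℓ² ≥ 6ℓ ≥ 36
    have hRl : (R + 1) * ℓ ≤ (4 * ℓ + 1) * ℓ := mul_le_mul_of_nonneg_right (by linarith) hℓ0.le
    linarith
  calc 16 * Real.exp 2 * x ^ 2 * B * Real.exp (4 * ℓ ^ 2) * Real.exp (-(3 * ℓ ^ 3))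
      = x ^ 2 * B * ((16 * Real.exp 2) * Real.exp (4 * ℓ ^ 2) * Real.exp (-(3 * ℓ ^ 3))) := by
        ring
    _ ≤ x ^ 2 * B * (Real.exp 5 * Real.exp (4 * ℓ ^ 2) * Real.exp (-(3 * ℓ ^ 3))) := by gcongr
    _ ≤ x ^ 2 * B * Real.exp (-ℓ ^ 3 - (R + 1) * ℓ) := by gcongr

/-! ### The horizontal sides -/

/-- `e^{R C₀} log(T+3)^R ≤ e^{4ℓ C₀} e^{4ℓ(2 + 3ℓ)}` for `0 ≤ R ≤ 4ℓ`, `T = exp(3ℓ³)`, `ℓ ≥ 2`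
(`log(T+3) ≤ 4ℓ³`, `log 4 ≤ 2`, `log ℓ ≤ ℓ`). [folklore] -/
theorem far_factor_le_wide {ℓ R T C₀ : ℝ} (hℓ2 : 2 ≤ ℓ) (hC₀ : 0 ≤ C₀) (hR0 : 0 ≤ R)
    (hR4 : R ≤ 4 * ℓ) (hT : T = Real.exp (3 * ℓ ^ 3)) :
    Real.exp (R * C₀) * Real.log (T + 3) ^ R ≤
      Real.exp (4 * ℓ * C₀) * Real.exp (4 * ℓ * (2 + 3 * ℓ)) := by
  obtain ⟨hT3, hlogT1, hlogT2⟩ := height_bounds hℓ2 hT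
  have hℓ3 : (2 : ℝ) ^ 3 ≤ ℓ ^ 3 := pow_le_pow_left₀ (by norm_num) hℓ2 3
  norm_num at hℓ3
  have hlogT0 : 0 < Real.log (T + 3) := by linarith
  have hℓ0 : 0 < ℓ := by linarith
  have hlog4ℓ : Real.log (Real.log (T + 3)) ≤ 2 + 3 * ℓ := by
    have h4 : Real.log (T + 3) ≤ 4 * ℓ ^ 3 := by linarith
    calc Real.log (Real.log (T + 3)) ≤ Real.log (4 * ℓ ^ 3) := Real.log_le_log hlogT0 h4
      _ = Real.log 4 + 3 * Real.log ℓ := by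
          rw [Real.log_mul (by norm_num) (by positivity), Real.log_pow]; push_cast; ring
      _ ≤ 2 + 3 * ℓ := by
          have h4' : Real.log 4 ≤ 2 := by
            have : Real.log 4 = 2 * Real.log 2 := by
              rw [show (4:ℝ) = 2 ^ 2 by norm_num, Real.log_pow]; push_cast; ring
            rw [this]; linarith [numerics.2.2]
          have hℓlog : Real.log ℓ ≤ ℓ := (Real.log_le_sub_one_of_pos hℓ0).trans (by linarith)
          linarith
  have hlogTR : Real.log (T + 3) ^ R ≤ Real.exp (4 * ℓ * (2 + 3 * ℓ)) := by
    rw [Real.rpow_def_of_pos hlogT0, Real.exp_le_exp]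
    calc Real.log (Real.log (T + 3)) * R ≤ (2 + 3 * ℓ) * R :=
          mul_le_mul_of_nonneg_right hlog4ℓ hR0
      _ ≤ (2 + 3 * ℓ) * (4 * ℓ) := mul_le_mul_of_nonneg_left hR4 (by linarith)
      _ = 4 * ℓ * (2 + 3 * ℓ) := by ring
  have hCf : Real.exp (R * C₀) ≤ Real.exp (4 * ℓ * C₀) :=
    Real.exp_le_exp.2 (mul_le_mul_of_nonneg_right hR4 hC₀)
  exact mul_le_mul hCf hlogTR (by positivity) (by positivity)

/-- **The horizontal sides are negligible (wide range)**:
`4 (a − b)((2x)^{1+a} e^{R C₀} log(T+3)^R B / T²) ≤ x² B e^{−ℓ³ − (R+1)ℓ}` for `0 ≤ R ≤ 4ℓ`,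
`ℓ ≥ 6`, once `ℓ ≥ C₀ + 3`. [folklore] -/
theorem hor_le_wide {x L ℓ R B T C₀ b : ℝ} (hx : 1 < x) (hL : L = Real.log x)
    (hℓ : ℓ = Real.log L) (hℓ6 : 6 ≤ ℓ) (hℓC : C₀ + 3 ≤ ℓ) (hC₀ : 0 ≤ C₀) (hR0 : 0 ≤ R)
    (hR4 : R ≤ 4 * ℓ) (hB : 0 ≤ B) (hT : T = Real.exp (3 * ℓ ^ 3)) (hb0 : 0 ≤ b)
    (hb1 : b ≤ 1 + 1 / L) :
    4 * ((1 + 1 / L - b) * ((2 * x) ^ (1 + (1 + 1 / L)) *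
      (Real.exp (R * C₀) * Real.log (T + 3) ^ R) * B / T ^ 2)) ≤
      x ^ 2 * B * Real.exp (-ℓ ^ 3 - (R + 1) * ℓ) := by
  have hℓ2 : 2 ≤ ℓ := by linarith
  obtain ⟨hx0, hxL, hL0, hLℓ, hL7, hx2, -⟩ := scales hx hL hℓ hℓ2
  obtain ⟨hℓ0, hsq, h6ℓ, h6ℓ2, -⟩ := cubes hℓ6
  obtain ⟨hT3, hlogT1, -⟩ := height_bounds hℓ2 hT
  have hT0 : 0 < T := by linarith
  have h2x := two_mul_rpow_line_le hx hL (by linarith)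
  have hab : 1 + 1 / L - b ≤ 2 := by
    have : 1 / L ≤ 1 := by rw [div_le_one hL0]; linarith
    linarith
  have hab0 : 0 ≤ 1 + 1 / L - b := by linarith
  have hlogT0 : 0 < Real.log (T + 3) := by linarith
  have hprod := far_factor_le_wide hℓ2 hC₀ hR0 hR4 hT
  have hT2 : 1 / T ^ 2 = Real.exp (-(6 * ℓ ^ 3)) := by
    rw [hT, ← Real.exp_nat_mul, Real.exp_neg]; field_simp; ring_nf
  -- LHS ≤ 8 · 4e²x² · e^{4ℓC₀} e^{4ℓ(2+3ℓ)} B e^{−6ℓ³}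
  have h1 : 4 * ((1 + 1 / L - b) * ((2 * x) ^ (1 + (1 + 1 / L)) *
      (Real.exp (R * C₀) * Real.log (T + 3) ^ R) * B / T ^ 2)) ≤
      32 * Real.exp 2 * x ^ 2 * B * (Real.exp (4 * ℓ * C₀) * Real.exp (4 * ℓ * (2 + 3 * ℓ))) *
        Real.exp (-(6 * ℓ ^ 3)) := by
    rw [div_eq_mul_one_div _ (T ^ 2), hT2]
    have hmain : (2 * x) ^ (1 + (1 + 1 / L)) * (Real.exp (R * C₀) * Real.log (T + 3) ^ R) * B ≤
        (4 * Real.exp 2 * x ^ 2) * (Real.exp (4 * ℓ * C₀) * Real.exp (4 * ℓ * (2 + 3 * ℓ))) * B :=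
      mul_le_mul_of_nonneg_right (mul_le_mul h2x hprod (by positivity) (by positivity)) hB
    calc 4 * ((1 + 1 / L - b) * ((2 * x) ^ (1 + (1 + 1 / L)) *
          (Real.exp (R * C₀) * Real.log (T + 3) ^ R) * B * Real.exp (-(6 * ℓ ^ 3))))
        ≤ 4 * (2 * ((4 * Real.exp 2 * x ^ 2) *
            (Real.exp (4 * ℓ * C₀) * Real.exp (4 * ℓ * (2 + 3 * ℓ))) * B *
            Real.exp (-(6 * ℓ ^ 3)))) := by
          gcongr 4 * ?_
          exact mul_le_mul hab (mul_le_mul_of_nonneg_right hmain (Real.exp_pos _).le)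
            (by positivity) (by norm_num)
      _ = _ := by ring
  refine h1.trans ?_
  have h32 : (32 : ℝ) * Real.exp 2 ≤ Real.exp 6 := by
    have e : Real.exp 6 = Real.exp 3 * Real.exp 1 * Real.exp 2 := by
      rw [← Real.exp_add, ← Real.exp_add]; norm_num
    rw [e]
    have h16 := numerics.1
    have h1' : (2 : ℝ) ≤ Real.exp 1 := by linarith [Real.add_one_le_exp (1:ℝ)]
    have h32' : (32 : ℝ) ≤ Real.exp 3 * Real.exp 1 := by
      nlinarith [mul_nonneg (sub_nonneg.2 h16) (sub_nonneg.2 h1')]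
    exact mul_le_mul_of_nonneg_right h32' (Real.exp_pos 2).le
  have hexp : Real.exp 6 * (Real.exp (4 * ℓ * C₀) * Real.exp (4 * ℓ * (2 + 3 * ℓ))) *
      Real.exp (-(6 * ℓ ^ 3)) ≤ Real.exp (-ℓ ^ 3 - (R + 1) * ℓ) := by
    rw [← Real.exp_add, ← Real.exp_add, ← Real.exp_add, Real.exp_le_exp]
    -- need: 6 + 4ℓC₀ + 8ℓ + 12ℓ² − 6ℓ³ ≤ −ℓ³ − (R+1)ℓ, using R ≤ 4ℓ, C₀ ≤ ℓ − 3, ℓ ≥ 6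
    have hC : 4 * ℓ * C₀ ≤ 4 * ℓ * (ℓ - 3) := mul_le_mul_of_nonneg_left (by linarith) (by linarith)
    have hRl : (R + 1) * ℓ ≤ (4 * ℓ + 1) * ℓ := mul_le_mul_of_nonneg_right (by linarith) hℓ0.le
    linarith
  calc 32 * Real.exp 2 * x ^ 2 * B * (Real.exp (4 * ℓ * C₀) * Real.exp (4 * ℓ * (2 + 3 * ℓ))) *
        Real.exp (-(6 * ℓ ^ 3))
      = x ^ 2 * B * ((32 * Real.exp 2) *
          (Real.exp (4 * ℓ * C₀) * Real.exp (4 * ℓ * (2 + 3 * ℓ))) * Real.exp (-(6 * ℓ ^ 3))) := by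
        ring
    _ ≤ x ^ 2 * B * (Real.exp 6 *
          (Real.exp (4 * ℓ * C₀) * Real.exp (4 * ℓ * (2 + 3 * ℓ))) * Real.exp (-(6 * ℓ ^ 3))) := by
        gcongr
    _ ≤ x ^ 2 * B * Real.exp (-ℓ ^ 3 - (R + 1) * ℓ) := by gcongr

/-! ### The left sides far from `1` -/

/-- **The left sides far from `1` are negligible (wide range)**:
`16π (2x)^{1+b} e^{R C₀} log(T+3)^R B ≤ x² B e^{−ℓ³ − (R+1)ℓ}` for `0 ≤ R ≤ 4ℓ`, `ℓ ≥ 6`, as soon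
as `β = L(1 − b) ≥ (C₀ + 20) ℓ³`. [folklore] -/
theorem far_le_wide {x L ℓ R B T C₀ b : ℝ} (hx : 1 < x) (hL : L = Real.log x)
    (hℓ : ℓ = Real.log L) (hℓ6 : 6 ≤ ℓ) (hC₀ : 0 ≤ C₀) (hR0 : 0 ≤ R) (hR4 : R ≤ 4 * ℓ)
    (hB : 0 ≤ B) (hT : T = Real.exp (3 * ℓ ^ 3)) (hb1 : b ≤ 1)
    (hβ : (C₀ + 20) * ℓ ^ 3 ≤ L * (1 - b)) :
    4 * (4 * π * ((2 * x) ^ (1 + b) * (Real.exp (R * C₀) * Real.log (T + 3) ^ R) * B)) ≤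
      x ^ 2 * B * Real.exp (-ℓ ^ 3 - (R + 1) * ℓ) := by
  have hℓ2 : 2 ≤ ℓ := by linarith
  obtain ⟨hx0, hxL, hL0, hLℓ, hL7, hx2, -⟩ := scales hx hL hℓ hℓ2
  obtain ⟨hℓ0, hsq, h6ℓ, h6ℓ2, h4ℓ⟩ := cubes hℓ6
  have h2x := two_mul_rpow_left_le hx hL hb1
  have hfac := far_factor_le_wide hℓ2 hC₀ hR0 hR4 hT
  have hπ4 : π ≤ 4 := Real.pi_lt_four.le
  obtain ⟨-, hlogT1, -⟩ := height_bounds hℓ2 hT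
  have hlogT0 : 0 ≤ Real.log (T + 3) := by linarith
  have hfac0 : 0 ≤ Real.exp (R * C₀) * Real.log (T + 3) ^ R :=
    mul_nonneg (Real.exp_pos _).le (Real.rpow_nonneg hlogT0 R)
  -- LHS ≤ 256 x² B e^{−L(1−b)} e^{4ℓC₀} e^{4ℓ(2+3ℓ)}
  have h1 : 4 * (4 * π * ((2 * x) ^ (1 + b) * (Real.exp (R * C₀) * Real.log (T + 3) ^ R) * B)) ≤
      256 * x ^ 2 * B * (Real.exp (-(L * (1 - b))) *
        (Real.exp (4 * ℓ * C₀) * Real.exp (4 * ℓ * (2 + 3 * ℓ)))) := by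
    have hmain : (2 * x) ^ (1 + b) * (Real.exp (R * C₀) * Real.log (T + 3) ^ R) * B ≤
        (4 * x ^ 2 * Real.exp (-(L * (1 - b)))) *
          (Real.exp (4 * ℓ * C₀) * Real.exp (4 * ℓ * (2 + 3 * ℓ))) * B :=
      mul_le_mul_of_nonneg_right (mul_le_mul h2x hfac hfac0 (by positivity)) hB
    have hlhs0 : 0 ≤ (2 * x) ^ (1 + b) * (Real.exp (R * C₀) * Real.log (T + 3) ^ R) * B :=
      mul_nonneg (mul_nonneg (by positivity) hfac0) hB
    calc 4 * (4 * π * ((2 * x) ^ (1 + b) * (Real.exp (R * C₀) * Real.log (T + 3) ^ R) * B))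
        ≤ 4 * (4 * 4 * ((4 * x ^ 2 * Real.exp (-(L * (1 - b)))) *
            (Real.exp (4 * ℓ * C₀) * Real.exp (4 * ℓ * (2 + 3 * ℓ))) * B)) := by
          gcongr 4 * ?_
          exact mul_le_mul (by linarith) hmain hlhs0 (by norm_num)
      _ = _ := by ring
  refine h1.trans ?_
  have h256 : (256 : ℝ) ≤ Real.exp 6 := by
    have e : Real.exp 6 = Real.exp 3 * Real.exp 3 := by rw [← Real.exp_add]; norm_num
    rw [e]; nlinarith [numerics.1]
  have hexp : Real.exp 6 * (Real.exp (-(L * (1 - b))) *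
      (Real.exp (4 * ℓ * C₀) * Real.exp (4 * ℓ * (2 + 3 * ℓ)))) ≤
      Real.exp (-ℓ ^ 3 - (R + 1) * ℓ) := by
    rw [← Real.exp_add, ← Real.exp_add, ← Real.exp_add, Real.exp_le_exp]
    -- 6 − L(1−b) + 4ℓC₀ + 8ℓ + 12ℓ² ≤ −ℓ³ − (R+1)ℓ, using L(1−b) ≥ (C₀+20)ℓ³, R ≤ 4ℓ, ℓ ≥ 6
    have hRl : (R + 1) * ℓ ≤ (4 * ℓ + 1) * ℓ := mul_le_mul_of_nonneg_right (by linarith) hℓ0.le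
    have hC : 4 * ℓ * C₀ ≤ C₀ * ℓ ^ 3 := by
      have := mul_le_mul_of_nonneg_right h4ℓ hC₀
      linarith
    linarith
  calc 256 * x ^ 2 * B * (Real.exp (-(L * (1 - b))) *
        (Real.exp (4 * ℓ * C₀) * Real.exp (4 * ℓ * (2 + 3 * ℓ))))
      = x ^ 2 * B * (256 * (Real.exp (-(L * (1 - b))) *
          (Real.exp (4 * ℓ * C₀) * Real.exp (4 * ℓ * (2 + 3 * ℓ))))) := by ring
    _ ≤ x ^ 2 * B * (Real.exp 6 * (Real.exp (-(L * (1 - b))) *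
          (Real.exp (4 * ℓ * C₀) * Real.exp (4 * ℓ * (2 + 3 * ℓ))))) := by gcongr
    _ ≤ x ^ 2 * B * Real.exp (-ℓ ^ 3 - (R + 1) * ℓ) := by gcongr

/-! ### The left sides near `1` -/

/-- **The left sides near `1` are negligible (wide range)**:
`16 (2x)^{1+b} e^{R M₀} e^{πR} B ((1−b)^{−R} + 2^R) ≤ x² B e^{−ℓ³ − (R+1)ℓ}` for `0 ≤ R ≤ 4ℓ`,
`ℓ ≥ 6`, as soon as `log(1/(1−b)) ≤ 1 + 3ℓ + Λ` and `β = L(1 − b) ≥ (M₀ + Λ + 20) ℓ³`.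
[folklore] -/
theorem near_le_wide {x L ℓ R B M₀ Λ b : ℝ} (hx : 1 < x) (hL : L = Real.log x)
    (hℓ : ℓ = Real.log L) (hℓ6 : 6 ≤ ℓ) (hM₀ : 0 ≤ M₀) (hΛ : 0 ≤ Λ) (hR0 : 0 ≤ R)
    (hR4 : R ≤ 4 * ℓ) (hB : 0 ≤ B) (hb0 : 0 ≤ b) (hb1 : b < 1)
    (hlog1b : Real.log (1 / (1 - b)) ≤ 1 + 3 * ℓ + Λ)
    (hβ : (M₀ + Λ + 20) * ℓ ^ 3 ≤ L * (1 - b)) :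
    4 * (4 * ((2 * x) ^ (1 + b) * Real.exp (R * M₀) * Real.exp (π * R) * B *
      ((1 - b) ^ (-R) + 2 ^ R))) ≤
      x ^ 2 * B * Real.exp (-ℓ ^ 3 - (R + 1) * ℓ) := by
  have hℓ2 : 2 ≤ ℓ := by linarith
  obtain ⟨hx0, hxL, hL0, hLℓ, hL7, hx2, -⟩ := scales hx hL hℓ hℓ2
  obtain ⟨hℓ0, hsq, h6ℓ, h6ℓ2, h4ℓ⟩ := cubes hℓ6
  have h1b : 0 < 1 - b := by linarith
  have h2x := two_mul_rpow_left_le hx hL hb1.le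
  have hπ4 : π ≤ 4 := Real.pi_lt_four.le
  have h4ℓ0 : 0 ≤ 4 * ℓ := by linarith
  -- the factors
  have hlog0 : 0 ≤ Real.log (1 / (1 - b)) :=
    Real.log_nonneg (by rw [le_div_iff₀ h1b]; linarith)
  have hpow1 : (1 - b) ^ (-R) ≤ Real.exp (4 * ℓ * (1 + 3 * ℓ + Λ)) := by
    rw [Real.rpow_def_of_pos h1b, Real.exp_le_exp]
    have e : Real.log (1 - b) * -R = R * Real.log (1 / (1 - b)) := by
      rw [one_div, Real.log_inv]; ring
    rw [e]
    calc R * Real.log (1 / (1 - b)) ≤ 4 * ℓ * Real.log (1 / (1 - b)) :=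
          mul_le_mul_of_nonneg_right hR4 hlog0
      _ ≤ 4 * ℓ * (1 + 3 * ℓ + Λ) := mul_le_mul_of_nonneg_left hlog1b h4ℓ0
  have hpow2 : (2 : ℝ) ^ R ≤ Real.exp (4 * ℓ * (1 + 3 * ℓ + Λ)) := by
    rw [Real.rpow_def_of_pos two_pos, Real.exp_le_exp]
    calc Real.log 2 * R ≤ 1 * (4 * ℓ) := mul_le_mul numerics.2.2 hR4 hR0 (by norm_num)
      _ ≤ 4 * ℓ * (1 + 3 * ℓ + Λ) := by nlinarith [mul_nonneg hℓ0.le hΛ, sq_nonneg ℓ]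
  have hsum : (1 - b) ^ (-R) + 2 ^ R ≤ 2 * Real.exp (4 * ℓ * (1 + 3 * ℓ + Λ)) := by linarith
  have hexpRM : Real.exp (R * M₀) * Real.exp (π * R) ≤ Real.exp (4 * ℓ * (M₀ + 4)) := by
    rw [← Real.exp_add, Real.exp_le_exp]
    linarith [mul_le_mul_of_nonneg_right hR4 hM₀, mul_le_mul hπ4 hR4 hR0 (by norm_num)]
  -- LHS ≤ 128 x² B e^{−L(1−b)} e^{4ℓ(M₀+4)} e^{4ℓ(1+3ℓ+Λ)}
  have h1 : 4 * (4 * ((2 * x) ^ (1 + b) * Real.exp (R * M₀) * Real.exp (π * R) * B *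
      ((1 - b) ^ (-R) + 2 ^ R))) ≤
      128 * x ^ 2 * B * (Real.exp (-(L * (1 - b))) * Real.exp (4 * ℓ * (M₀ + 4)) *
        Real.exp (4 * ℓ * (1 + 3 * ℓ + Λ))) := by
    have hmain : (2 * x) ^ (1 + b) * Real.exp (R * M₀) * Real.exp (π * R) * B *
        ((1 - b) ^ (-R) + 2 ^ R) ≤
        (4 * x ^ 2 * Real.exp (-(L * (1 - b)))) * Real.exp (4 * ℓ * (M₀ + 4)) * B *
          (2 * Real.exp (4 * ℓ * (1 + 3 * ℓ + Λ))) := by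
      have e : (2 * x) ^ (1 + b) * Real.exp (R * M₀) * Real.exp (π * R) * B =
          (2 * x) ^ (1 + b) * (Real.exp (R * M₀) * Real.exp (π * R)) * B := by ring
      rw [e]
      refine mul_le_mul ?_ hsum (by positivity) (by positivity)
      exact mul_le_mul_of_nonneg_right (mul_le_mul h2x hexpRM (by positivity) (by positivity)) hB
    calc 4 * (4 * ((2 * x) ^ (1 + b) * Real.exp (R * M₀) * Real.exp (π * R) * B *
          ((1 - b) ^ (-R) + 2 ^ R)))
        ≤ 4 * (4 * ((4 * x ^ 2 * Real.exp (-(L * (1 - b)))) * Real.exp (4 * ℓ * (M₀ + 4)) * B *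
            (2 * Real.exp (4 * ℓ * (1 + 3 * ℓ + Λ))))) := by gcongr
      _ = _ := by ring
  refine h1.trans ?_
  have h128 : (128 : ℝ) ≤ Real.exp 6 := by
    have e : Real.exp 6 = Real.exp 3 * Real.exp 3 := by rw [← Real.exp_add]; norm_num
    rw [e]; nlinarith [numerics.1]
  have hexp : Real.exp 6 * (Real.exp (-(L * (1 - b))) * Real.exp (4 * ℓ * (M₀ + 4)) *
      Real.exp (4 * ℓ * (1 + 3 * ℓ + Λ))) ≤ Real.exp (-ℓ ^ 3 - (R + 1) * ℓ) := by
    rw [← Real.exp_add, ← Real.exp_add, ← Real.exp_add, Real.exp_le_exp]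
    -- 6 − L(1−b) + 4ℓ(M₀+4) + 4ℓ(1+3ℓ+Λ) ≤ −ℓ³ − (R+1)ℓ
    have hRl : (R + 1) * ℓ ≤ (4 * ℓ + 1) * ℓ := mul_le_mul_of_nonneg_right (by linarith) hℓ0.le
    have hMΛ : 4 * ℓ * (M₀ + Λ) ≤ (M₀ + Λ) * ℓ ^ 3 := by
      have := mul_le_mul_of_nonneg_right h4ℓ (add_nonneg hM₀ hΛ)
      linarith
    linarith
  calc 128 * x ^ 2 * B * (Real.exp (-(L * (1 - b))) * Real.exp (4 * ℓ * (M₀ + 4)) *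
        Real.exp (4 * ℓ * (1 + 3 * ℓ + Λ)))
      = x ^ 2 * B * (128 * (Real.exp (-(L * (1 - b))) * Real.exp (4 * ℓ * (M₀ + 4)) *
          Real.exp (4 * ℓ * (1 + 3 * ℓ + Λ)))) := by ring
    _ ≤ x ^ 2 * B * (Real.exp 6 * (Real.exp (-(L * (1 - b))) * Real.exp (4 * ℓ * (M₀ + 4)) *
          Real.exp (4 * ℓ * (1 + 3 * ℓ + Λ)))) := by gcongr
    _ ≤ x ^ 2 * B * Real.exp (-ℓ ^ 3 - (R + 1) * ℓ) := by gcongr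

end RieszDiffWide

/-- **Stub E2a (the four negligible contour terms, `R ≤ 4 log log x`)** (stub
`stub_rieszDiffNegligibleWide` of line `Sketch`, crux `DiscMajorantLog`).  ∀-closed conjunction of
the wide-range analogues of `RieszDiff.tails_le`, `hor_le`, `far_le`, `near_le` (`T = e^{3ℓ³}`,
`ℓ = log log x ≥ 6`, `0 ≤ R ≤ 4ℓ`; same right-hand side `x² B e^{−ℓ³ − (R+1)ℓ}`):
`RieszDiffWide.tails_le_wide`, `hor_le_wide`, `far_le_wide`, `near_le_wide`.
[cite: MontgomeryVaughan2007, §7.4 pp. 177–178] -/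
theorem stub_rieszDiffNegligibleWide :
    ∀ (x L ℓ R B T C₀ M₀ Λ b : ℝ), 1 < x → L = Real.log x → ℓ = Real.log L → 6 ≤ ℓ →
      0 ≤ R → R ≤ 4 * ℓ → 0 ≤ B → T = Real.exp (3 * ℓ ^ 3) →
      (4 * ((2 * x) ^ (1 + (1 + 1 / L)) * (B / (1 / L) ^ R) / T) ≤
          x ^ 2 * B * Real.exp (-ℓ ^ 3 - (R + 1) * ℓ)) ∧
      (C₀ + 3 ≤ ℓ → 0 ≤ C₀ → 0 ≤ b → b ≤ 1 + 1 / L →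
        4 * ((1 + 1 / L - b) * ((2 * x) ^ (1 + (1 + 1 / L)) *
          (Real.exp (R * C₀) * Real.log (T + 3) ^ R) * B / T ^ 2)) ≤
          x ^ 2 * B * Real.exp (-ℓ ^ 3 - (R + 1) * ℓ)) ∧
      (0 ≤ C₀ → b ≤ 1 → (C₀ + 20) * ℓ ^ 3 ≤ L * (1 - b) →
        4 * (4 * Real.pi * ((2 * x) ^ (1 + b) * (Real.exp (R * C₀) * Real.log (T + 3) ^ R) * B)) ≤
          x ^ 2 * B * Real.exp (-ℓ ^ 3 - (R + 1) * ℓ)) ∧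
      (0 ≤ M₀ → 0 ≤ Λ → 0 ≤ b → b < 1 → Real.log (1 / (1 - b)) ≤ 1 + 3 * ℓ + Λ →
        (M₀ + Λ + 20) * ℓ ^ 3 ≤ L * (1 - b) →
        4 * (4 * ((2 * x) ^ (1 + b) * Real.exp (R * M₀) * Real.exp (Real.pi * R) * B *
          ((1 - b) ^ (-R) + 2 ^ R))) ≤
          x ^ 2 * B * Real.exp (-ℓ ^ 3 - (R + 1) * ℓ)) := by
  intro x L ℓ R B T C₀ M₀ Λ b hx hL hℓ hℓ6 hR0 hR4 hB hT
  exact ⟨RieszDiffWide.tails_le_wide hx hL hℓ hℓ6 hR4 hB hT,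
    fun hℓC hC₀ hb0 hb1 => RieszDiffWide.hor_le_wide hx hL hℓ hℓ6 hℓC hC₀ hR0 hR4 hB hT hb0 hb1,
    fun hC₀ hb1 hβ => RieszDiffWide.far_le_wide hx hL hℓ hℓ6 hC₀ hR0 hR4 hB hT hb1 hβ,
    fun hM₀ hΛ hb0 hb1 hlog1b hβ =>
      RieszDiffWide.near_le_wide hx hL hℓ hℓ6 hM₀ hΛ hR0 hR4 hB hb0 hb1 hlog1b hβ⟩

end Summit.Parity.BatemanHorn.Cruxes.DiscMajorantLog.Sketch
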